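import Summits.ValiantsHypothesis.ValiantsHypothesis.Theses.DivisionGap
import Summits.ValiantsHypothesis.ValiantsHypothesis.Theorems.PerDivisionHard.Negative.LoadBearing
import Summits.ValiantsHypothesis.ValiantsHypothesis.Theorems.PerDivisionHard.Negative.VarsCounting

/-!
# `DivisionGap.PerMultiplesHard` (stmt-ValiantsHypothesis-5068): load-bearing hypotheses, tightness
window and the floor — negative knowledge from the standing disprover

The crux `PerMultiplesHard` (strong form of H1 of route DivisionGap, the multiplier `h` NOT charged)
reads `∀ c, ∃ n₀, ∀ n ≥ n₀, ∀ h : ℝ≥0[x_ij], h ≠ 0 → 2 ^ ((Nat.log 2 n + c) ^ c) < L(per_n · h)` with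
`L = complexity` over the semiring `ℝ≥0` (monotone fan-in-two circuits): the monotone EXCLUSION
complexity of the permanent (Bürgisser 2004 §1.1, `EC(g) = min {L(f) : f ≠ 0, g ∣ f}`) is
super-quasi-polynomial.  All statements below are INLINE variants of it (no new named facts); the
facts used (`complexity_zero/one`, `perPoly_fin_zero/one`, `berkowitz_bound_le_qp`,
`complexity_perPoly_le_factorial`, `sq_le_of_pair`) are the sibling seat's
(`Theorems/PerDivisionHard/Negative/`).

* `not_perMultiplesHard_of_not_perDivisionHard` — the crux implies the weaker crux `PerDivisionHard`
  (contrapositive form): a refutation of H1 refutes it.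
* `perMultiplesHard_false_without_nonzero` — `h ≠ 0` deleted: false (`h = 0`).
* `perMultiplesHard_false_without_threshold`, `multiple_at_one_eq_zero` — no `n₀`: false at `n = 0, 1`.
* `perMultiplesHard_false_uniform` — `∃ n₀ ∀ c`: false.
* `perMultiplesHard_false_of_charTwo`, `perMultiplesHard_false_over_zmod2` — the semiring `ℝ≥0`
  replaced by a nontrivial commutative ring of characteristic two: false (`per = det`, Berkowitz), so
  monotonicity is load-bearing.
* `exists_multiple_le_factorial`, `perMultiplesHard_false_at_factorial_rate` — tightness window:
  the threshold cannot be raised to `(n+1)·n!` (`h = 1`).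
* `perMultiplesHard_rung_zero`, `perMultiplesHard_rung_one`, `two_le_of_perMultiplesHard_rung_fails` —
  the instances `c = 0` (from `n = 3`) and `c = 1` (from `n = 5`) HOLD, by the variable count
  `n² ≤ 2·L(per_n · h) + 1`; every counterexample exponent is at least `2`.

Why no refutation of the crux itself is attempted: see `Negative/ExclusionBridge.lean` — a refutation
would make the border determinantal complexity of `per_n` quasi-polynomial infinitely often
(Bürgisser 2004 Thm 1.3), i.e. refute the quasi-polynomial Mulmuley–Sohoni hypothesis.
-/

noncomputable section

namespace Summit.ValiantsHypothesis.Theorems.PerMultiplesHardNegative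

open Literature.Computability.AlgebraicComplexity MvPolynomial
open Summit.ValiantsHypothesis.ValiantsHypothesis.Theses.DivisionGap (PerMultiplesHard PerDivisionHard)
open Summit.ValiantsHypothesis.Theorems.PerDivisionHardNegative
open scoped NNReal

/-! ### Relation to the weaker crux -/

/-- **`PerMultiplesHard → PerDivisionHard`** (not charging `h` only strengthens the lower bound), in
contrapositive form: a refutation of H1 `PerDivisionHard` refutes `PerMultiplesHard`. [folklore] -/
theorem not_perMultiplesHard_of_not_perDivisionHard (hneg : ¬ PerDivisionHard) : ¬ PerMultiplesHard :=
  fun H => hneg fun c => (H c).imp fun _ hn₀ n hn g hg =>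
    Nat.lt_of_lt_of_le (hn₀ n hn g hg) (Nat.le_add_right _ _)

/-! ### Load-bearing hypotheses -/

/-- **`h ≠ 0` is load-bearing.** With the hypothesis `h ≠ 0` deleted the crux is false: `h = 0`.
[folklore] -/
theorem perMultiplesHard_false_without_nonzero :
    ¬ ∀ c : ℕ, ∃ n₀ : ℕ, ∀ n ≥ n₀, ∀ h : MvPolynomial (Fin n × Fin n) ℝ≥0,
        2 ^ ((Nat.log 2 n + c) ^ c) < complexity (perPoly (Fin n) ℝ≥0 * h) := by
  intro H
  obtain ⟨n₀, hn₀⟩ := H 0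
  have h := hn₀ n₀ le_rfl 0
  rw [mul_zero, complexity_zero] at h
  exact Nat.not_lt_zero _ h

/-- **The threshold `n₀` is load-bearing.** Claimed for every `n`, the crux is false at `n = 0`,
`h = 1` (`per_0 · 1 = 1` is a free constant). [folklore] -/
theorem perMultiplesHard_false_without_threshold :
    ¬ ∀ c : ℕ, ∀ n : ℕ, ∀ h : MvPolynomial (Fin n × Fin n) ℝ≥0, h ≠ 0 →
        2 ^ ((Nat.log 2 n + c) ^ c) < complexity (perPoly (Fin n) ℝ≥0 * h) := by
  intro H
  have h := H 0 0 1 one_ne_zero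
  rw [mul_one, perPoly_fin_zero, complexity_one] at h
  exact Nat.not_lt_zero _ h

/-- The degenerate instance `n = 1` as well: `L(per_1 · 1) = L(x₀₀) = 0`. [folklore] -/
theorem multiple_at_one_eq_zero : complexity (perPoly (Fin 1) ℝ≥0 * 1) = 0 := by
  rw [mul_one, perPoly_fin_one, complexity_X_holds]

/-- **The dependence `c ↦ n₀(c)` is load-bearing.** With one `n₀` for all `c` the crux is false
(at `n = n₀`, `h = 1`, exponent `c = L(per_{n₀}) + 1`). [folklore] -/
theorem perMultiplesHard_false_uniform :
    ¬ ∃ n₀ : ℕ, ∀ c : ℕ, ∀ n ≥ n₀, ∀ h : MvPolynomial (Fin n × Fin n) ℝ≥0, h ≠ 0 →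
        2 ^ ((Nat.log 2 n + c) ^ c) < complexity (perPoly (Fin n) ℝ≥0 * h) := by
  rintro ⟨n₀, H⟩
  set D := complexity (perPoly (Fin n₀) ℝ≥0 * 1) with hD
  have h := H (D + 1) n₀ le_rfl 1 one_ne_zero
  rw [← hD] at h
  have h1 : D + 1 ≤ (Nat.log 2 n₀ + (D + 1)) ^ (D + 1) := by
    calc D + 1 ≤ Nat.log 2 n₀ + (D + 1) := Nat.le_add_left _ _
      _ = (Nat.log 2 n₀ + (D + 1)) ^ 1 := (pow_one _).symm
      _ ≤ (Nat.log 2 n₀ + (D + 1)) ^ (D + 1) := Nat.pow_le_pow_right (by omega) (by omega)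
  have h2 : (Nat.log 2 n₀ + (D + 1)) ^ (D + 1) < 2 ^ ((Nat.log 2 n₀ + (D + 1)) ^ (D + 1)) :=
    Nat.lt_two_pow_self
  omega

/-- **Monotonicity (no cancellation in `ℝ≥0`) is load-bearing.** Over a nontrivial commutative ring
of characteristic two `per = det` (`perPoly_eq_detPoly_of_charP_two`) and `L(det_n) ≤ 8(n+1)^7`
(`complexity_detPoly_le`, Berkowitz), so the multiple `h = 1` is cheap; witness `c = 4`.
[cite: Burgisser2000, §2.1] -/
theorem perMultiplesHard_false_of_charTwo (k : Type) [CommRing k] [CharP k 2] [Nontrivial k] :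
    ¬ ∀ c : ℕ, ∃ n₀ : ℕ, ∀ n ≥ n₀, ∀ h : MvPolynomial (Fin n × Fin n) k, h ≠ 0 →
        2 ^ ((Nat.log 2 n + c) ^ c) < complexity (perPoly (Fin n) k * h) := by
  intro H
  obtain ⟨n₀, hn₀⟩ := H 4
  have h := hn₀ n₀ le_rfl 1 one_ne_zero
  rw [mul_one, perPoly_eq_detPoly_of_charP_two] at h
  have hdet := complexity_detPoly_le k n₀
  have hqp := berkowitz_bound_le_qp n₀
  omega

/-- The instance `k = 𝔽₂`. [cite: Burgisser2000, §2.1] -/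
theorem perMultiplesHard_false_over_zmod2 :
    ¬ ∀ c : ℕ, ∃ n₀ : ℕ, ∀ n ≥ n₀, ∀ h : MvPolynomial (Fin n × Fin n) (ZMod 2), h ≠ 0 →
        2 ^ ((Nat.log 2 n + c) ^ c) < complexity (perPoly (Fin n) (ZMod 2) * h) :=
  perMultiplesHard_false_of_charTwo (ZMod 2)

/-! ### Tightness window -/

/-- **The trivial multiple.** `h = 1` costs at most `(n+1)·n!`. [cite: JerrumSnir1982, §4.3] -/
theorem exists_multiple_le_factorial (n : ℕ) :
    ∃ h : MvPolynomial (Fin n × Fin n) ℝ≥0, h ≠ 0 ∧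
      complexity (perPoly (Fin n) ℝ≥0 * h) ≤ (n + 1) * n.factorial :=
  ⟨1, one_ne_zero, by rw [mul_one]; exact complexity_perPoly_le_factorial n⟩

/-- **Refuted strengthening (factorial rate).** The threshold cannot be raised to `(n+1)·n!`.
[cite: JerrumSnir1982, §4.3] -/
theorem perMultiplesHard_false_at_factorial_rate :
    ¬ ∃ n₀ : ℕ, ∀ n ≥ n₀, ∀ h : MvPolynomial (Fin n × Fin n) ℝ≥0, h ≠ 0 →
        (n + 1) * n.factorial < complexity (perPoly (Fin n) ℝ≥0 * h) := by
  rintro ⟨n₀, H⟩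
  obtain ⟨h, hne, hle⟩ := exists_multiple_le_factorial n₀
  exact absurd (H n₀ le_rfl h hne) (not_lt.mpr hle)

/-! ### The floor: rungs `c = 0, 1` hold -/

/-- **Rung `c = 0` of the crux holds** (threshold `2`; from `n = 3`). [folklore] -/
theorem perMultiplesHard_rung_zero :
    ∃ n₀ : ℕ, ∀ n ≥ n₀, ∀ h : MvPolynomial (Fin n × Fin n) ℝ≥0, h ≠ 0 →
      2 ^ ((Nat.log 2 n + 0) ^ 0) < complexity (perPoly (Fin n) ℝ≥0 * h) := by
  refine ⟨3, fun n hn h hh => ?_⟩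
  have hsq := sq_le_of_pair hh
  have h9 : 3 * 3 ≤ n * n := Nat.mul_le_mul hn hn
  rw [pow_zero, pow_one]
  omega

/-- **Rung `c = 1` of the crux holds** (threshold `2^{⌊log₂ n⌋+1} ≤ 2n`; from `n = 5`). [folklore] -/
theorem perMultiplesHard_rung_one :
    ∃ n₀ : ℕ, ∀ n ≥ n₀, ∀ h : MvPolynomial (Fin n × Fin n) ℝ≥0, h ≠ 0 →
      2 ^ ((Nat.log 2 n + 1) ^ 1) < complexity (perPoly (Fin n) ℝ≥0 * h) := by
  refine ⟨5, fun n hn h hh => ?_⟩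
  have hsq := sq_le_of_pair hh
  have h25 : 5 * n ≤ n * n := Nat.mul_le_mul_right n hn
  have hlog : 2 ^ Nat.log 2 n ≤ n := Nat.pow_log_le_self 2 (by omega)
  rw [pow_one, pow_succ]
  omega

/-- **Every counterexample exponent is at least `2`:** if the rung `c` of the crux fails then
`2 ≤ c`. [folklore] -/
theorem two_le_of_perMultiplesHard_rung_fails {c : ℕ}
    (hc : ¬ ∃ n₀ : ℕ, ∀ n ≥ n₀, ∀ h : MvPolynomial (Fin n × Fin n) ℝ≥0, h ≠ 0 →
      2 ^ ((Nat.log 2 n + c) ^ c) < complexity (perPoly (Fin n) ℝ≥0 * h)) : 2 ≤ c := by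
  by_contra h
  interval_cases c
  · exact hc perMultiplesHard_rung_zero
  · exact hc perMultiplesHard_rung_one

end Summit.ValiantsHypothesis.Theorems.PerMultiplesHardNegative

end
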